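import Summits.RiemannHypothesis.RiemannHypothesis.Theorems.SemilocalSoninPolyWindow
import Summits.RiemannHypothesis.RiemannHypothesis.Theorems.SemilocalNegCert
import HarnessLib

/-!
# The Weil side of the semilocal Sonin bridge for a polynomial window, and the one-call certificate corollary

Cell `rh-explicit`, seat cc-s2-1 (HOME `run/shared/lean/pub/rh-explicit/`; lead rulings R7-12/R7-12a, PHASE 2).  Companion of
`SemilocalSoninPolyWindow` (G-side regularity, CC's moments, the `K` bound).  Here:

* **Weil side** (`weilSide_polyWitness_le_lhsQ`): for `G = polyWitness c.p c.b` (ANY parity — seat cc-s2-4's parity-free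
  increment identity `weilIncrement_polyWitness_eq_ev'`, `SemilocalPolyIncrement`) the jump datum of the bridge,
  `(log 2/√2)·D_{log 2}(G) + ∫_{(0,∞)} w·D(G)`, is finite and bounded by the rational `c.lhsQ` of cc-s2-4's certificate record
  `WeilNegCert2` (`SemilocalNegCert`: `evalUpperQ` at the 20-digit enclosure of `log 2`, THEOREM B `archMajorL` on `(0, 2b]`,
  `archTailQ` beyond) — the record's oddness test and polar order `ne` are simply not used; hence
  `… − C₂‖G‖₂² < C` for every rational `C` with `c.lhsQ − c2SharpQ·normSq c.p c.b < C` (`weilSide_polyWitness_lt`,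
  `c2SharpQ ≤ C₂` from `SemilocalTwoConstantSharp`);
* **the kernel in closed form** (`weilConv_polyWitness_weilReflect_of_le` / `_of_lt`): `(G ⋆ G̃)(t) = ev (kappaL g b) |t|`
  for `|t| ≤ 2b` and `0` beyond — the Sonin-side files integrate `T_2` of exactly this against `⟨η|ϑ(e^t)η⟩`;
* **the corollary** `not_semilocalSoninIneqOn_two_of_polyWitness`: `not_semilocalSoninIneqOn_two_of_bdd_witness_one` with
  every hypothesis about `G` discharged from equalities / inequalities of rationals (side conditions of the enclosures,
  `g = F″ + F′/2` with `F(±b) = F′(±b) = 0`, the `C`- and `K`-budgets) and the Sonin-side data `(η; ε, d, B, Gm, N)` taken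
  against RATIONAL budgets, the final inequality `C(Gm + 4(2N + d)d) < B − K(2N + d)d` in `ℚ` — the shape of seat cc-s2-3's
  `SoninCert.checkData`; conclusion `¬ SemilocalSoninIneqOn 2 a` for every `a > c.b`.

Proof-only file (no definitions, no named facts). [folklore]
-/

set_option linter.dupNamespace false  -- the mandated namespace repeats `RiemannHypothesis`

noncomputable section

open MeasureTheory Complex Set Filter Topology Finset FourierTransform
open scoped Real ComplexConjugate ENNReal

namespace Summit.RiemannHypothesis.RiemannHypothesis.Theorems.SemilocalPolyWitness

open Literature.NumberTheory.LFunctions Literature.NumberTheory.ConnesConsani2021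
  Summit.RiemannHypothesis.RiemannHypothesis.Theorems.MotivicDoor
  Summit.RiemannHypothesis.RiemannHypothesis.Theorems.MotivicDoor.SemilocalMarkov LQ
  Summit.RiemannHypothesis.RiemannHypothesis.SoninCert

/-! ## The autocorrelation kernel of a polynomial window in closed form -/

section Kernel

variable {p : List ℚ} {b : ℚ}

/-- The autocorrelation kernel of a polynomial window is the real integral `∫ g(u) g(u − t) du`. [folklore] -/
theorem weilConv_polyWitness_weilReflect_eq (t : ℝ) :
    weilConv (polyWitness p b) (weilReflect (polyWitness p b)) t
      = ((∫ u, polyWitnessRe p b u * polyWitnessRe p b (u - t) : ℝ) : ℂ) := by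
  rw [weilConv_apply, ← integral_complex_ofReal]
  refine integral_congr_ae (Eventually.of_forall fun u ↦ ?_)
  simp only [polyWitness, weilReflect, Complex.conj_ofReal, neg_sub]
  push_cast; ring

/-- **Closed form of the kernel**: `(G ⋆ G̃)(t) = κ(|t|) = ev (kappaL g b) |t|` for `|t| ≤ 2b` (cc-s2-4's
autocorrelation list `kappaL`). [folklore] -/
theorem weilConv_polyWitness_weilReflect_of_le {t : ℝ} (ht : |t| ≤ 2 * b) :
    weilConv (polyWitness p b) (weilReflect (polyWitness p b)) t = ((ev (kappaL p b) |t| : ℝ) : ℂ) := by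
  rw [weilConv_polyWitness_weilReflect_eq]
  congr 1
  rcases le_or_gt 0 t with h0 | h0
  · rw [abs_of_nonneg h0] at ht ⊢
    rw [← integral_add_right_eq_self (fun u ↦ polyWitnessRe p b u * polyWitnessRe p b (u - t)) t]
    simp only [add_sub_cancel_right]
    exact integral_polyWitnessRe_shift_mul h0 ht
  · rw [abs_of_neg h0] at ht ⊢
    have e : ∀ u, polyWitnessRe p b u * polyWitnessRe p b (u - t)
        = polyWitnessRe p b (u + -t) * polyWitnessRe p b u := fun u ↦ by rw [← sub_eq_add_neg, mul_comm]
    simp_rw [e]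
    exact integral_polyWitnessRe_shift_mul (by linarith) ht

/-- The kernel vanishes for `|t| > 2b`. [folklore] -/
theorem weilConv_polyWitness_weilReflect_of_lt {t : ℝ} (ht : 2 * (b : ℝ) < |t|) :
    weilConv (polyWitness p b) (weilReflect (polyWitness p b)) t = 0 := by
  rw [weilConv_polyWitness_weilReflect_eq]
  rcases le_or_gt 0 t with h0 | h0
  · rw [abs_of_nonneg h0] at ht
    rw [← integral_add_right_eq_self (fun u ↦ polyWitnessRe p b u * polyWitnessRe p b (u - t)) t]
    simp only [add_sub_cancel_right]
    rw [integral_polyWitnessRe_shift_mul_of_lt ht]; simp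
  · rw [abs_of_neg h0] at ht
    have e : ∀ u, polyWitnessRe p b u * polyWitnessRe p b (u - t)
        = polyWitnessRe p b (u + -t) * polyWitnessRe p b u := fun u ↦ by rw [← sub_eq_add_neg, mul_comm]
    simp_rw [e]
    rw [integral_polyWitnessRe_shift_mul_of_lt ht]; simp

end Kernel

/-! ## The Weil-side jump datum of a polynomial window -/

/-- **Weil side, any parity.**  For `G = polyWitness c.p c.b` with `0 < b ≤ 1`, `log 2 ≤ 2b` (20-digit enclosure), enclosure
orders `nA, nt ≥ 1`, `D(0) = 0` on the increment list and the tail ratio test: `w·D(G)` is integrable on `(0, ∞)` and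
`(log 2/√2)·D_{log 2}(G) + ∫_{(0,∞)} w·D(G) ≤ c.lhsQ`. [folklore] -/
theorem weilSide_polyWitness_le_lhsQ (c : WeilNegCert2) (hb0 : 0 < c.b) (hb1 : c.b ≤ 1)
    (h2b : logTwoHi20 ≤ 2 * c.b) (hnA : 0 < c.nA) (hnt : 0 < c.nt)
    (hhead : (incrementL c.p c.b).headD 0 = 0) (htail1 : invPartialExpQ c.nt (2 * (2 * c.b)) < 1) :
    IntegrableOn (fun t ↦ weilArchDensity t * weilIncrement (polyWitness c.p c.b) t) (Set.Ioi 0) ∧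
      Real.log 2 / Real.sqrt 2 * weilIncrement (polyWitness c.p c.b) (Real.log 2)
          + (∫ t in Set.Ioi (0 : ℝ), weilArchDensity t * weilIncrement (polyWitness c.p c.b) t)
        ≤ (c.lhsQ : ℝ) := by
  set p := c.p
  set b := c.b
  have hb2' : ((2 * b : ℚ) : ℝ) ≤ 2 := by
    have h2 : 2 * b ≤ (2 : ℚ) := by linarith
    exact_mod_cast h2
  set G := polyWitness p b with hG
  set inc := incrementL p b
  set N : ℝ := (LQ.normSq p b : ℝ)
  have hNeq : ∫ x, ‖G x‖ ^ 2 = N := integral_norm_sq_polyWitness (p := p) hb0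
  have hN0 : 0 ≤ N := by rw [← hNeq]; exact integral_nonneg fun x ↦ by positivity
  -- D on (0, 2b]: D(t) = ev inc t = t · ev q t, q ≥ 0
  have hDev : ∀ t ∈ Set.Ioc (0 : ℝ) ((2 * b : ℚ) : ℝ), weilIncrement G t = ev inc t := fun t ht ↦
    weilIncrement_polyWitness_eq_ev' hb0 ht.1.le (by push_cast at ht; exact ht.2)
  have hDq : ∀ t ∈ Set.Ioc (0 : ℝ) ((2 * b : ℚ) : ℝ), weilIncrement G t = t * ev c.q t := fun t ht ↦ by
    rw [hDev t ht, ev_eq_headD_add_tail, hhead]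
    push_cast
    rw [zero_add]
    rfl
  have hq : ∀ t ∈ Set.Ioc (0 : ℝ) ((2 * b : ℚ) : ℝ), 0 ≤ ev c.q t := fun t ht ↦ by
    have h1 := weilIncrement_nonneg G t
    rw [hDq t ht] at h1
    exact (mul_nonneg_iff_of_pos_left ht.1).1 h1
  -- bulk
  obtain ⟨hintA, hA⟩ := setIntegral_weilArchDensity_mul_le (D := weilIncrement G) (by positivity) hb2' hDq hq
    c.nA c.mA c.KA hnA
  -- tail
  have h2b0 : (0 : ℚ) < 2 * b := by positivity
  obtain ⟨hintW, _⟩ := setIntegral_Ioi_weilArchDensity_le c.Kt (c := ((2 * b : ℚ) : ℝ)) (by exact_mod_cast h2b0)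
  have hT := setIntegral_Ioi_weilArchDensity_le_archTailQ c.Kt hnt h2b0 htail1
  have hDtail : EqOn (fun t ↦ weilArchDensity t * weilIncrement G t) (fun t ↦ 2 * N * weilArchDensity t)
      (Set.Ioi ((2 * b : ℚ) : ℝ)) := fun t ht ↦ by
    simp only
    rw [weilIncrement_polyWitness_eq_of_lt' hb0 (by push_cast at ht; exact ht)]
    ring
  have hintW' : IntegrableOn (fun t ↦ 2 * N * weilArchDensity t) (Set.Ioi ((2 * b : ℚ) : ℝ)) :=
    hintW.const_mul (2 * N)
  have hintT : IntegrableOn (fun t ↦ weilArchDensity t * weilIncrement G t) (Set.Ioi ((2 * b : ℚ) : ℝ)) :=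
    hintW'.congr_fun hDtail.symm measurableSet_Ioi
  have hTail : ∫ t in Set.Ioi ((2 * b : ℚ) : ℝ), weilArchDensity t * weilIncrement G t
      ≤ 2 * N * archTailQ (2 * b) c.Kt c.nt := by
    rw [setIntegral_congr_fun measurableSet_Ioi hDtail, integral_const_mul]
    exact mul_le_mul_of_nonneg_left hT (by positivity)
  -- the whole half-line
  have hunion : Set.Ioc (0 : ℝ) ((2 * b : ℚ) : ℝ) ∪ Set.Ioi ((2 * b : ℚ) : ℝ) = Set.Ioi (0 : ℝ) :=
    Set.Ioc_union_Ioi_eq_Ioi (by exact_mod_cast h2b0.le)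
  have hfin : IntegrableOn (fun t ↦ weilArchDensity t * weilIncrement G t) (Set.Ioi (0 : ℝ)) := by
    rw [← hunion]; exact hintA.union hintT
  have hInt : ∫ t in Set.Ioi (0 : ℝ), weilArchDensity t * weilIncrement G t
      ≤ (evQ (integ (mul (archMajorL c.nA c.mA c.KA) c.q)) (2 * b) : ℝ) + 2 * N * archTailQ (2 * b) c.Kt c.nt := by
    rw [← hunion, setIntegral_union Set.Ioc_disjoint_Ioi_same measurableSet_Ioi hintA hintT]
    exact add_le_add hA hTail
  -- the value at log 2
  have hlog2mem : Real.log 2 ∈ Set.Ioc (0 : ℝ) ((2 * b : ℚ) : ℝ) :=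
    ⟨Real.log_pos one_lt_two, by
      have h2b' : ((logTwoHi20 : ℚ) : ℝ) ≤ ((2 * b : ℚ) : ℝ) := by exact_mod_cast h2b
      exact log_two_le_logTwoHi20.trans h2b'⟩
  have hDlog : weilIncrement G (Real.log 2) ≤ (evalUpperQ inc logTwoLo20 (logTwoHi20 - logTwoLo20) : ℝ) := by
    rw [hDev _ hlog2mem]
    exact ev_le_evalUpperQ inc logTwoLo20_le (by push_cast; linarith [log_two_le_logTwoHi20])
  have hDlog0 : 0 ≤ weilIncrement G (Real.log 2) := weilIncrement_nonneg G _
  have hcoef : Real.log 2 / Real.sqrt 2 ≤ (logTwoHi20 : ℝ) / sqrtTwoLo :=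
    div_le_div₀ (by rw [logTwoHi20]; norm_num) log_two_le_logTwoHi20 sqrtTwoLo_pos sqrtTwoLo_le
  have hcoef0 : 0 ≤ Real.log 2 / Real.sqrt 2 := by positivity
  have hL : Real.log 2 / Real.sqrt 2 * weilIncrement G (Real.log 2)
      ≤ (logTwoHi20 : ℝ) / sqrtTwoLo * evalUpperQ inc logTwoLo20 (logTwoHi20 - logTwoLo20) :=
    mul_le_mul hcoef hDlog hDlog0 (hcoef0.trans hcoef)
  refine ⟨hfin, ?_⟩
  rw [WeilNegCert2.lhsQ]; push_cast; linarith

/-- **Weil-side budget**: with the side conditions of `weilSide_polyWitness_le_lhsQ`, every rational `C` with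
`c.lhsQ − c2SharpQ·normSq c.p c.b < C` bounds the bridge's datum `(log 2/√2)D_{log 2}(G) + ∫₀^∞ w·D(G) − C₂‖G‖₂² < C`
(`c2SharpQ ≤ C₂ = semilocalTwoConstant`). [folklore] -/
theorem weilSide_polyWitness_lt (c : WeilNegCert2) (hb0 : 0 < c.b) (hb1 : c.b ≤ 1)
    (h2b : logTwoHi20 ≤ 2 * c.b) (hnA : 0 < c.nA) (hnt : 0 < c.nt)
    (hhead : (incrementL c.p c.b).headD 0 = 0) (htail1 : invPartialExpQ c.nt (2 * (2 * c.b)) < 1)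
    {C : ℚ} (hC : c.lhsQ - c2SharpQ * LQ.normSq c.p c.b < C) :
    Real.log 2 / Real.sqrt 2 * weilIncrement (polyWitness c.p c.b) (Real.log 2)
        + (∫ t in Set.Ioi (0 : ℝ), weilArchDensity t * weilIncrement (polyWitness c.p c.b) t)
        - semilocalTwoConstant * ∫ x : ℝ, ‖polyWitness c.p c.b x‖ ^ 2 < C := by
  have h := (weilSide_polyWitness_le_lhsQ c hb0 hb1 h2b hnA hnt hhead htail1).2
  rw [integral_norm_sq_polyWitness hb0]
  have hN0 : (0 : ℝ) ≤ LQ.normSq c.p c.b := by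
    rw [← integral_norm_sq_polyWitness (p := c.p) hb0]; exact integral_nonneg fun x ↦ by positivity
  have hc2 : (c2SharpQ : ℝ) * LQ.normSq c.p c.b ≤ semilocalTwoConstant * LQ.normSq c.p c.b :=
    mul_le_mul_of_nonneg_right c2SharpQ_le hN0
  have hC' : ((c.lhsQ - c2SharpQ * LQ.normSq c.p c.b : ℚ) : ℝ) < (C : ℝ) := Rat.cast_lt.2 hC
  push_cast at hC'
  linarith

/-! ## The certificate corollary: every hypothesis on `G` from rationals -/

/-- **Refutation of `SemilocalSoninIneqOn 2 a` (`a > b`) from a polynomial-window certificate.**  Test-function side: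
cc-s2-4's record `c : WeilNegCert2` read as `(g, b; nA, mA, KA; Kt, nt)` (oddness NOT required, `ne` unused) with its
enclosure side conditions, `g = F″ + F′/2` and `F(±b) = F′(±b) = 0` (CC's two moments), the Weil budget
`c.lhsQ − c2SharpQ·normSq g b < C` and the twist budget `(3/2 + 1.41422)·2b·normSq g b < K`; Sonin side: an a.e.-even
`η ∈ L²` vanishing a.e. on `[−1, 1]` with band energy `≤ ε`, `ε·10⁷/572 ≤ d²`, `0 ≤ d < ‖η‖`,
`B ≤ Re⟨η|ϑ(T_2(G⋆G̃))η⟩`, `‖θ_2η‖² ≤ Gm`, `‖η‖ ≤ N`; and the one inequality `C(Gm + 4(2N+d)d) < B − K(2N+d)d` — all budgets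
rational, so on concrete data every numerical hypothesis is `decide`. [folklore] -/
theorem not_semilocalSoninIneqOn_two_of_polyWitness (c : WeilNegCert2) {F : List ℚ}
    (hb0 : 0 < c.b) (hb1 : c.b ≤ 1) (hblog : c.b < logTwoLo20) (h2b : logTwoHi20 ≤ 2 * c.b)
    (hnA : 0 < c.nA) (hnt : 0 < c.nt) (hhead : (incrementL c.p c.b).headD 0 = 0)
    (htail1 : invPartialExpQ c.nt (2 * (2 * c.b)) < 1)
    (hg : c.p = add (derivL (derivL F)) (smul (1 / 2) (derivL F)))
    (hF1 : evQ (derivL F) c.b = 0) (hF2 : evQ (derivL F) (-c.b) = 0)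
    (hF3 : evQ F c.b = 0) (hF4 : evQ F (-c.b) = 0)
    {C K : ℚ} (hC : c.lhsQ - c2SharpQ * LQ.normSq c.p c.b < C) (hC0 : 0 ≤ C)
    (hK : (3 / 2 + 141422 / 100000) * (2 * c.b) * LQ.normSq c.p c.b < K)
    {η : Lp ℂ 2 (volume : Measure ℝ)} (hev : η ∈ evenPart) (hvan : η ∈ vanishOn 1)
    {ε d B Gm N : ℚ}
    (hε : ∫ x in Set.Icc (-1 : ℝ) 1, ‖((𝓕 η : Lp ℂ 2 (volume : Measure ℝ)) : ℝ → ℂ) x‖ ^ 2 ≤ ε)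
    (hdε : ε * 10000000 / 572 ≤ d ^ 2) (hd0 : 0 ≤ d) (hdη : (d : ℝ) < ‖η‖)
    (hB : (B : ℝ) ≤ (soninTraceForm (twistKernel 2
      (weilConv (polyWitness c.p c.b) (weilReflect (polyWitness c.p c.b)))) (η : ℝ → ℂ)).re)
    (hGm : ‖primeTwist 2 η‖ ^ 2 ≤ Gm) (hN : ‖η‖ ≤ N)
    (hineq : C * (Gm + 4 * (2 * N + d) * d) < B - K * (2 * N + d) * d)
    {a : ℝ} (ha : (c.b : ℝ) < a) : ¬ SemilocalSoninIneqOn 2 a := by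
  have hblt : (c.b : ℝ) < Real.log 2 := lt_of_lt_of_le (by exact_mod_cast hblog) logTwoLo20_le
  obtain ⟨hfin, _⟩ := weilSide_polyWitness_le_lhsQ c hb0 hb1 h2b hnA hnt hhead htail1
  have hCw := weilSide_polyWitness_lt c hb0 hb1 h2b hnA hnt hhead htail1 hC
  have h1 : mulFourier (polyWitness c.p c.b) (I / 2) = 0 :=
    mulFourier_polyWitness_I_half_eq_zero hb0 hg hF1 hF2
  have h0 : mulFourier (polyWitness c.p c.b) 0 = 0 :=
    mulFourier_polyWitness_zero_eq_zero hb0 hg hF1 hF2 hF3 hF4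
  have hKr := integral_norm_twistKernel_polyWitness_lt (p := c.p) hb0 hK
  have hdε' : (ε : ℝ) / (1 - 9999428 / 10000000) ≤ (d : ℝ) ^ 2 := by
    have h : ((ε * 10000000 / 572 : ℚ) : ℝ) ≤ ((d ^ 2 : ℚ) : ℝ) := Rat.cast_le.2 hdε
    push_cast at h
    have e : (ε : ℝ) / (1 - 9999428 / 10000000) = ε * 10000000 / 572 := by norm_num; ring
    rw [e]; exact h
  have hineq' : (C : ℝ) * ((Gm : ℝ) + 4 * ((2 * N + d) * d)) < B - K * ((2 * N + d) * d) := by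
    have h : ((C * (Gm + 4 * (2 * N + d) * d) : ℚ) : ℝ) < ((B - K * (2 * N + d) * d : ℚ) : ℝ) :=
      Rat.cast_lt.2 hineq
    push_cast at h
    convert h using 1 <;> ring
  exact not_semilocalSoninIneqOn_two_of_bdd_witness_one (G := polyWitness c.p c.b) (M := (absBound c.p c.b : ℝ))
    measurable_polyWitness (norm_polyWitness_le hb0) (fun _ hx ↦ polyWitness_eq_zero_of_lt hx)
    (by exact_mod_cast hb0.le) ha hblt ae_continuousAt_polyWitness hfin h1 h0 hev hvan
    hε hdε' (by exact_mod_cast hd0) hdη hB hGm hN hCw (by exact_mod_cast hC0) hKr hineq'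

end Summit.RiemannHypothesis.RiemannHypothesis.Theorems.SemilocalPolyWitness

end
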